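import Mathlib
import Literature.NumberTheory.LFunctions.Zhang2022.Section13Eq1311Assembly
import Literature.NumberTheory.LFunctions.Zhang2022.Section13ZeroSumsPoly
import Literature.NumberTheory.LFunctions.Zhang2022.Section13Eval137Bypass
import Literature.NumberTheory.LFunctions.Zhang2022.Section13ZeroSumsL
import Literature.NumberTheory.LFunctions.Zhang2022.Section13MeanSquareL
import HarnessLib

/-!
# Zhang (2022) §13 (13.11): the leaf `Skeleton.Eq1311Rel c′ c137` modulo the ONE remaining zero-sum
# `Q(L₂L₃)` — Z-POLY, Z-L (i) and the bypass edge plugged into the assembly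

Topic `Literature/NumberTheory/LFunctions/Zhang2022` (Landau–Siegel audit tree; verdict-neutral).
Y. Zhang, *Discrete mean estimates and the Landau–Siegel zero*, arXiv:2211.02515v1 (2022)
[Zhang2022LandauSiegel], §13 p. 75, (13.11) «𝓔 = o(𝔓)» (GAP-LEDGER G-L3t6-3; lane ZHANG-L WP14,
leaf h1311, owner zl-w14-p5). **An unrefereed manuscript under adjudication; nothing here asserts its
Theorems 1–2.**

`eq1311Rel_of_zeroSumL23`: for `c′ ≥ 0` with `Prop22 c′`, the leaf `Eq1311Rel c′ c137` follows from the
ONE remaining bound `ΣΣ_ρ |L(ρ+β₁)/L′(ρ)||L(ρ+β₂)L(ρ+β₃)|²|ω(ρ)| ≤ C·P²·𝓛⁴⁵` (Z-L (ii), zl-w14-p1; the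
S1 term, paid by `t₀⁻¹`) — the other seven inputs of `eq1311Rel_of_zeroSums` (`Section13Eq1311Assembly`)
being landed theorems: Z-POLY `zeroSum_{Bpoly,Nchar_Bpoly,E1poly_Bpoly,Nchar}_sq_le_of_prop22`
(`Section13ZeroSumsPoly`, zl-w14-p3), Z-L (i) `zeroSum_L_sq_le_of_prop22 9 meanSq_L_le`
(`Section13ZeroSumsL`, zl-w14-p2; `Section13MeanSquareL`, zl-w14-p7; `𝔓𝓛^{9+9}`), at `c₀ = c137`
(`Section13C137`). `eval137Rel_of_zeroSumL23`: the same input gives the consumed node `Eval137Rel c′`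
through the landed bypass edge `eval137Rel_of_1311Rel_of_prop22` (`Section13Eval137Bypass`, zl-w14-p6).
Kernel edges only; no definitions, no new facts.

## References

* Y. Zhang, arXiv:2211.02515v1 (2022), §13 (13.7), (13.11) p. 75. [cite: Zhang2022LandauSiegel, §13 (13.11) p.75]
-/

noncomputable section

open Complex Real Finset

namespace Literature.NumberTheory.LFunctions.Zhang2022.Typed.Section13

open Skeleton

/-- **(13.11) at `c₀ = c137` modulo `Q(L₂L₃)`**: for `0 ≤ c′` with `Prop22 c′`, the bound
`Q(L₂L₃) ≤ C·P²·𝓛⁴⁵` gives `Skeleton.Eq1311Rel c′ c137` (all other zero-sums are tree theorems).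
[cite: Zhang2022LandauSiegel, §13 (13.11) p.75] -/
theorem eq1311Rel_of_zeroSumL23 {c' : ℝ} (hc' : 0 ≤ c') (h22 : Prop22 c')
    (hZ23 : ∃ C : ℝ, ForAllLarge fun D _ χ => AssumptionA D χ →
      ∑ x ∈ finsetOf (PsiOne χ), ∑ ρ ∈ finsetOf (zeroSet D x),
        ‖x.ψ.LFunction (ρ + beta1 c' D) / deriv x.ψ.LFunction ρ‖ *
          ‖x.ψ.LFunction (ρ + beta2 c' D) * x.ψ.LFunction (ρ + beta3 c' D)‖ ^ 2 * ‖omegaW D ρ‖ ≤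
        C * bigP D ^ 2 * ell D ^ 45) :
    Eq1311Rel c' c137 :=
  eq1311Rel_of_zeroSums c' c137 c137_pos hZ23 (zeroSum_Bpoly_sq_le_of_prop22 hc' h22)
    (zeroSum_L_sq_le_of_prop22 9 meanSq_L_le hc' h22)
    (zeroSum_Nchar_Bpoly_sq_le_of_prop22 hc' h22) (zeroSum_E1poly_Bpoly_sq_le_of_prop22 hc' h22)
    (zeroSum_Nchar_sq_le_of_prop22 hc' h22)

/-- **`Eval137Rel c′` modulo `Q(L₂L₃)`** (the node v19 consumes, `Ξ₁₄ = −i(Φ₁+Φ₂−Φ₃) + o((𝔞+1)𝔓)`):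
the leaf above composed with the landed bypass edge `eval137Rel_of_1311Rel_of_prop22` (repaired (13.7) +
Rem137). [cite: Zhang2022LandauSiegel, §13 (13.7), (13.11) p.75] -/
theorem eval137Rel_of_zeroSumL23 {c' : ℝ} (hc' : 0 ≤ c') (h22 : Prop22 c')
    (hZ23 : ∃ C : ℝ, ForAllLarge fun D _ χ => AssumptionA D χ →
      ∑ x ∈ finsetOf (PsiOne χ), ∑ ρ ∈ finsetOf (zeroSet D x),
        ‖x.ψ.LFunction (ρ + beta1 c' D) / deriv x.ψ.LFunction ρ‖ *
          ‖x.ψ.LFunction (ρ + beta2 c' D) * x.ψ.LFunction (ρ + beta3 c' D)‖ ^ 2 * ‖omegaW D ρ‖ ≤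
        C * bigP D ^ 2 * ell D ^ 45) :
    Eval137Rel c' :=
  eval137Rel_of_1311Rel_of_prop22 hc' h22 (eq1311Rel_of_zeroSumL23 hc' h22 hZ23)

end Literature.NumberTheory.LFunctions.Zhang2022.Typed.Section13
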